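import Mathlib
import HarnessLib

/-!
# Matrix units in a `ᴴ`-closed subalgebra of `M_n(ℂ)` — Wedderburn–Artin for finite-dimensional `*`-algebras of matrices

statement-level skeleton of published theorems with citation tags; proofs where landed; nothing here is a claim about
the Yang–Mills mass gap

A subalgebra `A ⊆ M_n(ℂ)` closed under the conjugate transpose is a SEMISIMPLE ring: its Jacobson radical `J` is a
nilpotent ideal, and for `x ∈ J` the element `xᴴx ∈ J` is a nilpotent HERMITIAN matrix, hence `0`, hence `x = 0`
(`isSemisimpleRing_of_conjTranspose_mem`).  Mathlib's Wedderburn–Artin theorem over the algebraically closed field `ℂ`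
(`IsSemisimpleRing.exists_algEquiv_pi_matrix_of_isAlgClosed`) then gives an algebra isomorphism
`A ≃ₐ[ℂ] Π_{i<m} M_{d_i}(ℂ)`, and pulling back the elementary matrices produces a SYSTEM OF MATRIX UNITS
`E i s t ∈ A` (`exists_matrixUnits`):
`E i s t · E i u v = δ_{tu} E i s v`, `E i s t · E j u v = 0` for `i ≠ j`, `Σ_i Σ_s E i s s = 1`, and every `a ∈ A` is a
`ℂ`-combination of the `E i s t`.  These are the classical structure facts for finite-dimensional `*`-algebras of
operators ([GoodmanWallachGTM255] §4.1.5–4.1.7: double commutant theorem, isotypic decomposition, Lemma 4.1.18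
«ρ(𝒜) = End(V₁) ⊕ ⋯ ⊕ End(V_r)»); here they are obtained from Mathlib's abstract Wedderburn–Artin theorem, the only
input specific to matrices being the `ᴴ`-argument for semisimplicity.  The companion file
`TracePreservingStarHom` uses these units to match two representations with the same character
([GoodmanWallachGTM255] Thm 4.1.19).

The matrix units are NOT claimed self-adjoint (the Wedderburn isomorphism is an algebra, not a `*`-algebra,
isomorphism); nothing here depends on that.
-/

open scoped ComplexOrder Matrix

namespace Literature.LinearAlgebra.Matrix

section HermitianNilpotent

variable {n : Type*} [Fintype n] [DecidableEq n]

/-- A Hermitian matrix `A` with `A ^ (2m) = 0` has `A ^ m = 0` (`A^{2m} = (A^m)ᴴ A^m`). [folklore] -/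
private theorem pow_eq_zero_of_isHermitian_pow_two_mul_eq_zero {A : Matrix n n ℂ} (hA : A.IsHermitian) (m : ℕ)
    (hm : A ^ (2 * m) = 0) : A ^ m = 0 := by
  have h1 : (A ^ m)ᴴ * A ^ m = 0 := by
    rw [Matrix.conjTranspose_pow, hA.eq, ← pow_add, ← two_mul, hm]
  exact Matrix.conjTranspose_mul_self_eq_zero.mp h1

/-- A nilpotent Hermitian matrix is zero. [folklore] -/
private theorem eq_zero_of_isHermitian_of_pow_eq_zero {A : Matrix n n ℂ} (hA : A.IsHermitian) {k : ℕ} (hk : A ^ k = 0) :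
    A = 0 := by
  have hAj : A ^ (2 ^ k) = 0 := by
    rw [← Nat.add_sub_cancel' (Nat.lt_two_pow_self (n := k)).le, pow_add, hk, zero_mul]
  have desc : ∀ j : ℕ, A ^ (2 ^ j) = 0 → A = 0 := by
    intro j
    induction j with
    | zero => simp
    | succ j ih =>
      intro h
      refine ih (pow_eq_zero_of_isHermitian_pow_two_mul_eq_zero hA _ ?_)
      rw [← pow_succ']
      exact h
  exact desc k hAj

end HermitianNilpotent

section Semisimple

variable {n : Type*} [Fintype n] [DecidableEq n]

/-- **A `ᴴ`-closed subalgebra of `M_n(ℂ)` is a semisimple ring.**  Proof: `A` is Artinian (finite-dimensional), so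
its Jacobson radical `J` is nilpotent; for `x ∈ J`, `xᴴx ∈ J` is Hermitian and nilpotent, hence `0`, hence `x = 0`;
an Artinian ring with `J = 0` is semisimple.  (The finite-dimensional case of: every finite-dimensional
`C⋆`-algebra is a direct sum of full matrix algebras; [GoodmanWallachGTM255] §4.1.5 Thm 4.1.13 / Lemma 4.1.18 for
`*`-closed algebras of operators, which are completely reducible since the orthogonal complement of an invariant
subspace is invariant.) [cite: GoodmanWallachGTM255, §4.1.5 Thm 4.1.13 and §4.1.7 Lemma 4.1.18] -/
theorem isSemisimpleRing_of_conjTranspose_mem (A : Subalgebra ℂ (Matrix n n ℂ))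
    (hA : ∀ a ∈ A, aᴴ ∈ A) : IsSemisimpleRing A := by
  haveI : IsArtinianRing A := IsArtinianRing.of_finite ℂ A
  rw [IsArtinianRing.isSemisimpleRing_iff_jacobson]
  obtain ⟨k, hk⟩ := (IsSemiprimaryRing.isNilpotent : IsNilpotent (Ring.jacobson A))
  refine eq_bot_iff.mpr fun x hx => ?_
  rw [Ideal.mem_bot]
  set y : A := ⟨(x : Matrix n n ℂ)ᴴ, hA _ x.2⟩ * x with hy
  have hyJ : y ∈ Ring.jacobson A := Ideal.mul_mem_left _ _ hx
  have hyk : y ^ k ∈ (Ring.jacobson A) ^ k := Ideal.pow_mem_pow hyJ k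
  rw [hk, Ideal.zero_eq_bot, Ideal.mem_bot] at hyk
  have hmat : (y : Matrix n n ℂ) ^ k = 0 := by
    have := congrArg Subtype.val hyk
    simpa using this
  have hyH : (y : Matrix n n ℂ).IsHermitian := by
    change ((x : Matrix n n ℂ)ᴴ * (x : Matrix n n ℂ)).IsHermitian
    exact Matrix.isHermitian_conjTranspose_mul_self _
  have hy0 : (y : Matrix n n ℂ) = 0 := eq_zero_of_isHermitian_of_pow_eq_zero hyH hmat
  have hx0 : (x : Matrix n n ℂ) = 0 := Matrix.conjTranspose_mul_self_eq_zero.mp hy0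
  exact Subtype.ext hx0

/-- The diagonal elementary matrices sum to the identity: `Σ_s E_{ss} = 1`. [folklore] -/
private theorem sum_single_diag_eq_one {ι : Type*} [Fintype ι] [DecidableEq ι] :
    ∑ s : ι, Matrix.single s s (1 : ℂ) = 1 := by
  ext a b
  simp only [Matrix.sum_apply, Matrix.single_apply, Matrix.one_apply]
  by_cases hab : a = b
  · subst hab
    simp
  · rw [if_neg hab]
    refine Finset.sum_eq_zero fun s _ => ?_
    rw [if_neg]
    rintro ⟨rfl, rfl⟩
    exact hab rfl

/-- **Matrix units in a `ᴴ`-closed subalgebra of `M_n(ℂ)` (Wedderburn–Artin).**  There are `m`, block sizes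
`d i ≥ 1` and elements `E i s t ∈ A` (`i < m`, `s, t < d i`) with the matrix-unit relations
`E i s t · E i u v = δ_{tu} E i s v`, `E i s t · E j u v = 0` (`i ≠ j`), `Σ_i Σ_s E i s s = 1`, spanning `A` over `ℂ`.
They are the pull-backs of the elementary matrices along an algebra isomorphism `A ≃ₐ[ℂ] Π_i M_{d_i}(ℂ)`
(Mathlib's Wedderburn–Artin theorem over the algebraically closed field `ℂ`, applied to the semisimple ring `A`).
[cite: GoodmanWallachGTM255, §4.1.7 Lemma 4.1.18] -/
theorem exists_matrixUnits (A : Subalgebra ℂ (Matrix n n ℂ)) (hA : ∀ a ∈ A, aᴴ ∈ A) :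
    ∃ (m : ℕ) (d : Fin m → ℕ) (E : (i : Fin m) → Fin (d i) → Fin (d i) → Matrix n n ℂ),
      (∀ i, 0 < d i) ∧
      (∀ i s t, E i s t ∈ A) ∧
      (∀ i (s t u v : Fin (d i)), E i s t * E i u v = if t = u then E i s v else 0) ∧
      (∀ i j, i ≠ j → ∀ (s t : Fin (d i)) (u v : Fin (d j)), E i s t * E j u v = 0) ∧
      (∑ i, ∑ s, E i s s = 1) ∧
      (∀ a ∈ A, ∃ c : (i : Fin m) → Fin (d i) → Fin (d i) → ℂ, a = ∑ i, ∑ s, ∑ t, c i s t • E i s t) := by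
  haveI := isSemisimpleRing_of_conjTranspose_mem A hA
  obtain ⟨m, d, hd, ⟨e⟩⟩ := IsSemisimpleRing.exists_algEquiv_pi_matrix_of_isAlgClosed ℂ A
  set u : (i : Fin m) → Fin (d i) → Fin (d i) → ((i : Fin m) → Matrix (Fin (d i)) (Fin (d i)) ℂ) :=
    fun i s t => Pi.single i (Matrix.single s t (1 : ℂ)) with hu
  refine ⟨m, d, fun i s t => (e.symm (u i s t) : Matrix n n ℂ), fun i => Nat.pos_of_ne_zero (hd i).ne,
    fun i s t => (e.symm (u i s t)).2, ?_, ?_, ?_, ?_⟩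
  · -- relations inside one block
    intro i s t u' v
    rw [← Subalgebra.coe_mul, ← map_mul]
    simp only [hu, ← Pi.single_mul]
    by_cases h : t = u'
    · subst h
      rw [Matrix.single_mul_single_same, mul_one, if_pos rfl]
    · rw [Matrix.single_mul_single_of_ne _ _ _ _ h, Pi.single_zero, map_zero, if_neg h]
      rfl
  · -- different blocks are orthogonal
    intro i j hij s t u' v
    rw [← Subalgebra.coe_mul, ← map_mul]
    have h0 : u i s t * u j u' v = 0 := by
      funext k
      simp only [hu, Pi.mul_apply, Pi.zero_apply]
      by_cases hk : k = j
      · subst hk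
        rw [Pi.single_eq_of_ne' hij, zero_mul]
      · rw [Pi.single_eq_of_ne hk, mul_zero]
    rw [h0, map_zero]
    rfl
  · -- the diagonal units sum to `1`
    have hsum : ∀ (i : Fin m) {ι : Type} (S : Finset ι) (f : ι → Matrix (Fin (d i)) (Fin (d i)) ℂ),
        Pi.single (M := fun i => Matrix (Fin (d i)) (Fin (d i)) ℂ) i (∑ x ∈ S, f x)
          = ∑ x ∈ S, Pi.single (M := fun i => Matrix (Fin (d i)) (Fin (d i)) ℂ) i (f x) := by
      intro i ι S f
      simpa only [AddMonoidHom.single_apply] using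
        map_sum (AddMonoidHom.single (fun i => Matrix (Fin (d i)) (Fin (d i)) ℂ) i) f S
    have h1 : ∑ i, ∑ s, u i s s = 1 := by
      have : ∀ i, ∑ s, u i s s = Pi.single i 1 := by
        intro i
        simp only [hu]
        rw [← hsum, sum_single_diag_eq_one]
      simp_rw [this]
      exact Finset.univ_sum_single (1 : (i : Fin m) → Matrix (Fin (d i)) (Fin (d i)) ℂ)
    have h2 : ∑ i, ∑ s, e.symm (u i s s) = 1 := by
      simp_rw [← map_sum]
      rw [h1, map_one]
    have h3 := congrArg (Subtype.val : A → Matrix n n ℂ) h2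
    simpa using h3
  · -- spanning
    intro a ha
    have hsum : ∀ (i : Fin m) {ι : Type} (S : Finset ι) (f : ι → Matrix (Fin (d i)) (Fin (d i)) ℂ),
        Pi.single (M := fun i => Matrix (Fin (d i)) (Fin (d i)) ℂ) i (∑ x ∈ S, f x)
          = ∑ x ∈ S, Pi.single (M := fun i => Matrix (Fin (d i)) (Fin (d i)) ℂ) i (f x) := by
      intro i ι S f
      simpa only [AddMonoidHom.single_apply] using
        map_sum (AddMonoidHom.single (fun i => Matrix (Fin (d i)) (Fin (d i)) ℂ) i) f S
    set x := e ⟨a, ha⟩ with hxdef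
    refine ⟨fun i s t => x i s t, ?_⟩
    have hx : x = ∑ i, ∑ s, ∑ t, (x i s t) • u i s t := by
      conv_lhs => rw [← Finset.univ_sum_single x]
      refine Finset.sum_congr rfl fun i _ => ?_
      calc Pi.single (M := fun i => Matrix (Fin (d i)) (Fin (d i)) ℂ) i (x i)
          = Pi.single (M := fun i => Matrix (Fin (d i)) (Fin (d i)) ℂ) i
              (∑ s, ∑ t, Matrix.single s t (x i s t)) := by
            rw [← Matrix.matrix_eq_sum_single]
        _ = ∑ s, ∑ t, Pi.single (M := fun i => Matrix (Fin (d i)) (Fin (d i)) ℂ) i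
              (Matrix.single s t (x i s t)) := by
            rw [hsum]
            refine Finset.sum_congr rfl fun s _ => ?_
            rw [hsum]
        _ = ∑ s, ∑ t, (x i s t) • u i s t := by
            refine Finset.sum_congr rfl fun s _ => Finset.sum_congr rfl fun t _ => ?_
            simp only [hu]
            rw [← Pi.single_smul, Matrix.smul_single, smul_eq_mul, mul_one]
    calc a = ((e.symm x : A) : Matrix n n ℂ) := by simp [hxdef]
      _ = ((e.symm (∑ i, ∑ s, ∑ t, (x i s t) • u i s t) : A) : Matrix n n ℂ) := by rw [← hx]
      _ = ∑ i, ∑ s, ∑ t, (x i s t) • (e.symm (u i s t) : Matrix n n ℂ) := by simp [map_sum, map_smul]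

end Semisimple

end Literature.LinearAlgebra.Matrix
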